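import Mathlib.NumberTheory.NumberField.CanonicalEmbedding.Basic
import Mathlib.LinearAlgebra.FreeModule.IdealQuotient
import Mathlib.NumberTheory.Cyclotomic.Basic
import Mathlib.Probability.Distributions.Uniform
import Literature.Computability.Cryptography.LWE
import Literature.Algebra.EuclideanLattices.DiscreteGaussian
import Literature.Algebra.EuclideanLattices.IntegerBases
import HarnessLib

-- provenance: harness21/H21/H21/Prelude/Lattice/RingLWE.lean @ cfecf1d (interim HEAD d8f2665); M5 mechanical rewrite
/-!
# Ring-LWE and Module-LWE (trunk T-LATTICE, G10, concept C9)

For a number field `K` with ring of integers `R = 𝓞 K` and a modulus `q`, we set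
`R_q = 𝓞 K ⧸ (q)` and define

* the discretised Gaussian error distribution on `𝓞 K` (pulled back from the discrete Gaussian on
  the image of `𝓞 K` in Mathlib's *Euclidean* mixed space `K_ℝ`) and its reduction mod `q`;
* the (normal-form) Ring-LWE sample distribution `(a, a • s + e)` on `R_q × R_q`
  (Lyubashevsky–Peikert–Regev 2013, §3; Peikert 2016, §4.4) and the Module-LWE distribution of rank
  `d` (Langlois–Stehlé 2015, §1), both as instances of the generic `Literature.Computability.Cryptography.LWE.lweSample`;
* the worst-case side: the ideal lattices `σ(𝔞) ⊆ K_ℝ` of fractional ideals `𝔞` of `K`, transported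
  to the Euclidean mixed space, and the predicate "this integer lattice instance is (isometric to) an
  ideal lattice of `K`" consumed by the Ideal-SVP → Ring-LWE reduction statements (`pqc.S29`).

Typical instance (docstring examples only, no new definitions): `K = CyclotomicField (2 ^ k) ℚ`, the
`2^k`-th cyclotomic field, whose ring of integers is `ℤ[ζ] ≅ ℤ[X]/(X^{2^{k-1}} + 1)`
(`IsCyclotomicExtension.Rat.isIntegralClosure_adjoin_singleton_of_prime_pow` in Mathlib).

## Mathlib

Everything number-theoretic is Mathlib's: `NumberField.RingOfIntegers` (`𝓞 K`), `Ideal.span`,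
`Ideal.finiteQuotientOfFreeOfNeBot`, `NumberField.mixedEmbedding`,
`NumberField.mixedEmbedding.integerLattice` (literally a `LinearMap.range`),
`NumberField.mixedEmbedding.idealLattice` with its `DiscreteTopology`/`IsZLattice` instances,
`NumberField.mixedEmbedding.euclidean.mixedSpace/toMixed/integerLattice`, `ZLattice.comap`,
`ZLattice.comap_equiv`, `LinearEquiv.ofInjective`.  Mathlib has no LWE/Ring-LWE material.  We do
*not* hand-roll images of ideals: `euclideanIdealLattice` is `ZLattice.comap` of Mathlib's
`idealLattice` along `euclidean.toMixed`, verbatim the pattern of Mathlib's `euclidean.integerLattice`.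

## Design

* (D2 of the outline) Ring-LWE and Module-LWE are `Literature.Computability.Cryptography.LWE.lweSample` over the finite ring
  `R = Rq K q` with `ι = Fin 1`, resp. `ι = Fin d`.  Hence `K : Type` (not `Type*`), as `Literature.LWE` lives
  in `Type` to keep `PMF.bind` mono-universe.
* (D6) Errors are the *discretised, non-dual* form: a discrete Gaussian on `σ(𝓞 K) ⊆ K_ℝ` pulled back
  to `𝓞 K`, then reduced mod `q`.  LPR 2013 use a continuous Gaussian on `K_ℝ` and secrets in the
  codifferent `R^∨_q`; for the cyclotomic power-of-two case `R^∨ = n⁻¹ R` and the two forms differ by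
  scaling (Peikert 2016, §4.4.1).  Caveat on norms: Mathlib's `euclidean.mixedSpace K` carries the norm
  `‖x‖² = ∑_{w real} |x_w|² + ∑_{w complex} |x_w|²` with *one* coordinate per complex place, which is
  `‖σ(x)‖_can / √2` on the complex coordinates compared with the canonical embedding into `ℂⁿ` used in
  LPR 2013; Gaussian parameters must be rescaled accordingly when comparing with the literature.
* Every declaration mentioning `euclidean.mixedSpace K` is prefixed by `open scoped Classical in`,
  exactly as in Mathlib (`Fintype {w // IsReal w}` is classical).

## References

* V. Lyubashevsky, C. Peikert, O. Regev, *On ideal lattices and learning with errors over rings*,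
  J. ACM 60 (2013), §3.
* A. Langlois, D. Stehlé, *Worst-case to average-case reductions for module lattices*,
  Des. Codes Cryptogr. 75 (2015), §1, §3.
* C. Peikert, *A decade of lattice cryptography*, Found. Trends TCS 10 (2016), §4.3–4.4.
-/

noncomputable section

open scoped ENNReal nonZeroDivisors NumberField
open NumberField NumberField.mixedEmbedding

namespace Literature.Computability.Cryptography

namespace RingLWE

/-! ### The quotient ring `R_q = 𝓞 K ⧸ (q)` -/

section Rq

variable (K : Type) [Field K] [NumberField K] (q : ℕ)

/-- The finite quotient ring `R_q = 𝓞 K ⧸ q 𝓞 K` of the ring of integers of the number field `K`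
by the principal ideal generated by the natural number `q` (Lyubashevsky–Peikert–Regev 2013, §3;
Peikert 2016, §4.4).  Example: for `K = CyclotomicField (2 ^ k) ℚ` this is
`ℤ_q[X]/(X^{2^{k-1}} + 1)`. [cite: LyubashevskyPeikertRegev2013, §3] -/
abbrev Rq : Type :=
  𝓞 K ⧸ Ideal.span {(q : 𝓞 K)}

/-- The ideal `(q) ⊆ 𝓞 K` is nonzero for `q ≠ 0` (`𝓞 K` has characteristic zero). [folklore] -/
theorem span_natCast_ne_bot [NeZero q] : Ideal.span {(q : 𝓞 K)} ≠ ⊥ := by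
  rw [ne_eq, Ideal.span_singleton_eq_bot]
  exact_mod_cast NeZero.ne q

/-- `R_q` is finite for `q ≠ 0`: `𝓞 K` is a free `ℤ`-module of finite rank and `(q) ≠ ⊥`
(`Ideal.finiteQuotientOfFreeOfNeBot`). [folklore] -/
instance instFiniteRq [NeZero q] : Finite (Rq K q) :=
  Ideal.finiteQuotientOfFreeOfNeBot _ (span_natCast_ne_bot K q)

/-- `R_q` as a `Fintype` (noncomputably, from finiteness), so that the uniform distribution
`PMF.uniformOfFintype (Rq K q)` and `Literature.Computability.Cryptography.LWE.lweSample` apply. [folklore] -/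
instance instFintypeRq [NeZero q] : Fintype (Rq K q) :=
  Fintype.ofFinite _

/-- `R_q` is nonempty (it contains `0`). [folklore] -/
instance instNonemptyRq : Nonempty (Rq K q) :=
  ⟨0⟩

/-- Classical decidable equality on `R_q` (needed by the joint search experiment of `Literature.LWE`). [folklore] -/
instance instDecidableEqRq : DecidableEq (Rq K q) :=
  Classical.decEq _

end Rq

/-! ### `𝓞 K` as a lattice in the Euclidean mixed space -/

section Lattice

variable (K : Type) [Field K]

/-- The `ℤ`-linear map `𝓞 K → K_ℝ = ℝ^{r₁} × ℂ^{r₂}`, `x ↦ (σ_w(x))_w` (the mixed embedding restricted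
to the ring of integers); its range is by definition Mathlib's `mixedEmbedding.integerLattice K`. [folklore] -/
def ringOfIntegersToMixed : 𝓞 K →ₗ[ℤ] mixedSpace K :=
  ((mixedEmbedding K).comp (algebraMap (𝓞 K) K)).toIntAlgHom.toLinearMap

/-- `ringOfIntegersToMixed K x = σ(x)`, the mixed embedding of `x : 𝓞 K` viewed in `K`. [folklore] -/
@[simp]
theorem ringOfIntegersToMixed_apply (x : 𝓞 K) :
    ringOfIntegersToMixed K x = mixedEmbedding K (x : K) := rfl

/-- The range of `ringOfIntegersToMixed` is Mathlib's `mixedEmbedding.integerLattice K`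
(definitionally). [folklore] -/
theorem range_ringOfIntegersToMixed :
    LinearMap.range (ringOfIntegersToMixed K) = mixedEmbedding.integerLattice K := rfl

variable [NumberField K]

/-- The mixed embedding is injective on `𝓞 K`. [folklore] -/
theorem ringOfIntegersToMixed_injective : Function.Injective (ringOfIntegersToMixed K) :=
  (mixedEmbedding_injective K).comp RingOfIntegers.coe_injective

open scoped Classical in
/-- The `ℤ`-linear isomorphism `𝓞 K ≃ σ(𝓞 K) ⊆ K_ℝ` between the ring of integers and its image
`euclidean.integerLattice K` in Mathlib's Euclidean mixed space: `LinearEquiv.ofInjective` onto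
`mixedEmbedding.integerLattice K` followed by transport along `euclidean.toMixed`
(`ZLattice.comap_equiv`).  (Peikert 2016, §4.3: "`R` embeds as a lattice in `K_ℝ`".) [cite: Peikert2016, §4.3: " R  embeds as a lattice in  K_ℝ "] -/
def ringOfIntegersEquivLattice : 𝓞 K ≃ₗ[ℤ] euclidean.integerLattice K :=
  (LinearEquiv.ofInjective (ringOfIntegersToMixed K) (ringOfIntegersToMixed_injective K)).trans
    (ZLattice.comap_equiv ℝ (mixedEmbedding.integerLattice K) (euclidean.toMixed K).toLinearEquiv)

open scoped Classical in
/-- Under `ringOfIntegersEquivLattice`, `x ∈ 𝓞 K` goes to (the Euclidean-space copy of) its mixed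
embedding `σ(x)`. [folklore] -/
@[simp]
theorem toMixed_ringOfIntegersEquivLattice (x : 𝓞 K) :
    euclidean.toMixed K (ringOfIntegersEquivLattice K x : euclidean.mixedSpace K) =
      mixedEmbedding K (x : K) := by
  change euclidean.toMixed K ((euclidean.toMixed K).symm (mixedEmbedding K (x : K))) = _
  exact (euclidean.toMixed K).apply_symm_apply _

/-! ### Error distributions -/

open scoped Classical in
/-- The discretised Gaussian error distribution on `𝓞 K` of parameter `s`: the discrete Gaussian
`D_{σ(𝓞 K), s}` (`Literature.Algebra.EuclideanLattices.discreteGaussian`, centre `0`) on the lattice `σ(𝓞 K) ⊆ K_ℝ` in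
Mathlib's Euclidean mixed space, pulled back to `𝓞 K` along `ringOfIntegersEquivLattice`.
This is the discretised, non-dual variant (design D6) of the error distribution of
Lyubashevsky–Peikert–Regev 2013, §3 (who use a continuous Gaussian on `K_ℝ` and the codifferent
`R^∨`); see the module docstring for the `√2` normalisation caveat on complex places.  Junk value:
the point mass at `0` for `s ≤ 0` (inherited from `discreteGaussian`). [cite: LyubashevskyPeikertRegev2013, §3 (who use a continuous Gaussian on  K_] -/
def gaussianErrorInt (s : ℝ) : PMF (𝓞 K) :=
  (Literature.Algebra.EuclideanLattices.discreteGaussian (euclidean.integerLattice K) s 0).map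
    (ringOfIntegersEquivLattice K).symm

/-- The Ring-LWE error distribution `χ = ψ mod q` on `R_q`: the discretised Gaussian on `𝓞 K` of
parameter `s` reduced modulo `q` (Lyubashevsky–Peikert–Regev 2013, §3; Peikert 2016, §4.4.1). [cite: LyubashevskyPeikertRegev2013, §3] -/
def gaussianError (q : ℕ) (s : ℝ) : PMF (Rq K q) :=
  (gaussianErrorInt K s).map (Ideal.Quotient.mk _)

open scoped Classical in
/-- Mass of the discretised Gaussian error at `x ∈ 𝓞 K`: it is the discrete-Gaussian mass of
`σ(x)` in the lattice `σ(𝓞 K)`. [folklore] -/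
theorem gaussianErrorInt_apply (s : ℝ) (x : 𝓞 K) :
    gaussianErrorInt K s x =
      Literature.Algebra.EuclideanLattices.discreteGaussian (euclidean.integerLattice K) s 0
        (ringOfIntegersEquivLattice K x) := by
  classical
  rw [gaussianErrorInt, PMF.map_apply, tsum_eq_single (ringOfIntegersEquivLattice K x)]
  · simp
  · intro b hb
    rw [if_neg]
    rintro rfl
    exact hb (LinearEquiv.apply_symm_apply _ _).symm

open scoped Classical in
/-- The support of the Gaussian error is all of `𝓞 K` for `0 < s`. [folklore] -/
theorem support_gaussianErrorInt {s : ℝ} (hs : 0 < s) :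
    (gaussianErrorInt K s).support = Set.univ := by
  rw [gaussianErrorInt, PMF.support_map, Literature.Algebra.EuclideanLattices.support_discreteGaussian _ hs, Set.image_univ]
  exact (ringOfIntegersEquivLattice K).symm.surjective.range_eq

end Lattice

/-! ### Ring-LWE and Module-LWE samples -/

section Samples

variable {K : Type} [Field K] [NumberField K] {q : ℕ} [NeZero q]

/-- The (normal-form) Ring-LWE distribution `A_{s,χ}` on `R_q × R_q`: sample `a ← U(R_q)`,
`e ← χ` and output `(a, a * s + e)` (Lyubashevsky–Peikert–Regev 2013, §3, in the non-dual
discretised form; Peikert 2016, Def. 4.4.1 and §4.4.1 "normal form"). [cite: LyubashevskyPeikertRegev2013, §3  in the non-dual discretised form] -/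
def ringLWESample (χ : PMF (Rq K q)) (s : Rq K q) : PMF (Rq K q × Rq K q) :=
  (PMF.uniformOfFintype (Rq K q)).bind fun a ↦ χ.map fun e ↦ (a, a * s + e)

/-- Mass of a single Ring-LWE sample: `A_{s,χ}(a, b) = |R_q|⁻¹ · χ(b - a s)` (a computation
from the definition; proved below as `ringLWESample_apply_holds`). [folklore] -/
def ringLWESample_apply : Prop :=
  ∀ (χ : PMF (Rq K q)) (s a b : Rq K q),
    ringLWESample χ s (a, b) = (Fintype.card (Rq K q) : ℝ≥0∞)⁻¹ * χ (b - a * s)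

/-- Discharge of `ringLWESample_apply`: unfold `PMF.bind`/`PMF.map`; only `a' = a` contributes to
the outer sum and only `e = b - a s` to the inner one. [folklore] -/
theorem ringLWESample_apply_holds : (ringLWESample_apply (K := K) (q := q)) := by
  intro χ s a b
  rw [ringLWESample, PMF.bind_apply, tsum_eq_single a]
  · rw [PMF.uniformOfFintype_apply, PMF.map_apply, tsum_eq_single (b - a * s)]
    · rw [if_pos]
      simp
    · intro e he
      rw [if_neg]
      intro h
      apply he
      have h2 := (Prod.mk.injEq _ _ _ _).mp h
      rw [h2.2]; abel
  · intro a' ha'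
    rw [PMF.map_apply, ENNReal.tsum_eq_zero.2, mul_zero]
    intro e
    rw [if_neg]
    intro h
    exact ha' ((Prod.mk.injEq _ _ _ _).mp h).1.symm

/-- Ring-LWE is LWE over the ring `R_q` in dimension one: `ringLWESample χ s` is the image of
`Literature.LWE.lweSample χ (fun _ : Fin 1 ↦ s)` under `(a, b) ↦ (a 0, b)` (design D2 of the outline;
Peikert 2016, §4.4). [cite: Peikert2016, §4.4] -/
def ringLWESample_eq_map_lweSample : Prop :=
  ∀ (χ : PMF (Rq K q)) (s : Rq K q),
    ringLWESample χ s =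
      (LWE.lweSample χ (fun _ : Fin 1 ↦ s)).map (Prod.map (fun a ↦ a 0) id)

/-- The first marginal of a Ring-LWE sample is uniform on `R_q` (a computation from the
definition; proved below as `ringLWESample_map_fst_holds`). [folklore] -/
def ringLWESample_map_fst : Prop :=
  ∀ (χ : PMF (Rq K q)) (s : Rq K q),
    (ringLWESample χ s).map Prod.fst = PMF.uniformOfFintype (Rq K q)

/-- Discharge of `ringLWESample_map_fst`: `map` commutes with `bind`, the inner map is constant
(`PMF.map_const`), and `p.bind pure = p`. [folklore] -/
theorem ringLWESample_map_fst_holds : (ringLWESample_map_fst (K := K) (q := q)) := by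
  intro χ s
  rw [ringLWESample, PMF.map_bind]
  conv_rhs => rw [← PMF.bind_pure (PMF.uniformOfFintype (Rq K q))]
  congr 1
  funext a
  rw [PMF.map_comp]
  exact PMF.map_const _ _

variable (q) in
/-- The Module-LWE distribution of rank `d` over `R_q`: `(a, ⟨a, s⟩ + e)` with `a ← U(R_q^d)`,
`e ← χ`; literally `Literature.Computability.Cryptography.LWE.lweSample` with `R = R_q`, `ι = Fin d` (Langlois–Stehlé 2015, §1 and
Def. 3.1, discretised non-dual form). [cite: LangloisStehle2015, §1 and Def. 3.1  discretised non-dual fo] -/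
def moduleLWESample (d : ℕ) (χ : PMF (Rq K q)) (s : Fin d → Rq K q) :
    PMF ((Fin d → Rq K q) × Rq K q) :=
  LWE.lweSample χ s

/-- Module-LWE of rank `1` is Ring-LWE (up to the identification `Fin 1 → R_q ≃ R_q`). [folklore] -/
def moduleLWESample_one_map : Prop :=
  ∀ (χ : PMF (Rq K q)) (s : Rq K q),
    (moduleLWESample q 1 χ (fun _ ↦ s)).map (Prod.map (fun a ↦ a 0) id) = ringLWESample χ s

/- interim proof relied on results that are now named facts (D-0014); demoted to a fact by the M5 import, proof preserved:
:=
  (ringLWESample_eq_map_lweSample χ s).symm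
-/

variable (K q) in
/-- A (randomised) decision Ring-LWE distinguisher on `m` samples: an `Literature.Computability.Cryptography.LWE.Distinguisher` over
`R = R_q`, `ι = Fin 1` (Lyubashevsky–Peikert–Regev 2013, §3, decision R-LWE). [cite: LyubashevskyPeikertRegev2013, §3  decision R-LWE] -/
abbrev Distinguisher (m : ℕ) : Type :=
  LWE.Distinguisher (Fin 1) (Rq K q) m

/-- The (average-case) decision Ring-LWE distinguishing advantage of `D` on `m` samples with error
distribution `χ`: the generic `Literature.Computability.Cryptography.LWE.distinguishingAdvantage` at `R = R_q`, `ι = Fin 1`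
(Lyubashevsky–Peikert–Regev 2013, §3; Peikert 2016, Def. 4.4.2). [cite: LyubashevskyPeikertRegev2013, §3] -/
abbrev distinguishingAdvantage (χ : PMF (Rq K q)) (m : ℕ) (D : Distinguisher K q m) : ℝ :=
  LWE.distinguishingAdvantage χ m D

/-- A Ring-LWE distinguishing advantage lies in `[0, 1]`. [folklore] -/
def distinguishingAdvantage_mem_Icc : Prop :=
  ∀ (χ : PMF (Rq K q)) (m : ℕ) (D : Distinguisher K q m),
    distinguishingAdvantage χ m D ∈ Set.Icc (0 : ℝ) 1

/- interim proof relied on results that are now named facts (D-0014); demoted to a fact by the M5 import, proof preserved: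
:=
  ⟨LWE.distinguishingAdvantage_nonneg χ m D, LWE.distinguishingAdvantage_le_one χ m D⟩
-/

end Samples

/-! ### Ideal lattices (worst-case side) -/

section IdealLattice

variable (K : Type) [Field K] [NumberField K]

open scoped Classical in
/-- The ideal lattice `σ(𝔞) ⊆ K_ℝ` of a fractional ideal `𝔞` of `K`, as a `ℤ`-submodule of Mathlib's
*Euclidean* mixed space: Mathlib's `mixedEmbedding.idealLattice K 𝔞` transported along
`euclidean.toMixed` (exactly as `euclidean.integerLattice` is obtained from
`mixedEmbedding.integerLattice`).  (Lyubashevsky–Peikert–Regev 2013, §2.3 "ideal lattices";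
Peikert 2016, §4.3.) [cite: LyubashevskyPeikertRegev2013, §2.3 "ideal lattices"] -/
def euclideanIdealLattice (𝔞 : (FractionalIdeal (𝓞 K)⁰ K)ˣ) :
    Submodule ℤ (euclidean.mixedSpace K) :=
  ZLattice.comap ℝ (mixedEmbedding.idealLattice K 𝔞) (euclidean.toMixed K).toLinearMap

open scoped Classical in
/-- An ideal lattice is discrete (transport of Mathlib's instance for `idealLattice`). [folklore] -/
instance instDiscreteTopologyEuclideanIdealLattice (𝔞 : (FractionalIdeal (𝓞 K)⁰ K)ˣ) :
    DiscreteTopology (euclideanIdealLattice K 𝔞) := by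
  rw [euclideanIdealLattice]
  infer_instance

open scoped Classical in
/-- An ideal lattice is a full `ℤ`-lattice in `K_ℝ` (transport of Mathlib's instance for
`idealLattice`). [folklore] -/
instance instIsZLatticeEuclideanIdealLattice (𝔞 : (FractionalIdeal (𝓞 K)⁰ K)ˣ) :
    IsZLattice ℝ (euclideanIdealLattice K 𝔞) := by
  simp_rw [euclideanIdealLattice]
  infer_instance

open scoped Classical in
/-- Membership in an ideal lattice: `x ∈ σ(𝔞)` iff `toMixed x = σ(y)` for some `y ∈ 𝔞`. [folklore] -/
theorem mem_euclideanIdealLattice (𝔞 : (FractionalIdeal (𝓞 K)⁰ K)ˣ) (x : euclidean.mixedSpace K) :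
    x ∈ euclideanIdealLattice K 𝔞 ↔
      ∃ y : K, y ∈ (𝔞 : Set K) ∧ mixedEmbedding K y = euclidean.toMixed K x := by
  rw [euclideanIdealLattice, ZLattice.comap, Submodule.mem_comap]
  exact mem_idealLattice K 𝔞

open scoped Classical in
/-- The ideal lattice of the unit ideal `(1) = 𝓞 K` is the integer lattice `σ(𝓞 K)` (both are
`ZLattice.comap` along `euclidean.toMixed` of the images of `(1 : FractionalIdeal) = 𝓞 K` in the
mixed space; proved below as `euclideanIdealLattice_one_holds`). [folklore] -/
def euclideanIdealLattice_one : Prop :=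
  euclideanIdealLattice K 1 = euclidean.integerLattice K

/-- Mathlib's `idealLattice K 1` is `mixedEmbedding.integerLattice K`
(`FractionalIdeal.mem_one_iff`). [folklore] -/
theorem idealLattice_one : mixedEmbedding.idealLattice K 1 = mixedEmbedding.integerLattice K := by
  ext x
  rw [mem_idealLattice]
  constructor
  · rintro ⟨y, hy, rfl⟩
    obtain ⟨y', rfl⟩ := (FractionalIdeal.mem_one_iff (S := (𝓞 K)⁰)).1
      (show y ∈ ((1 : (FractionalIdeal (𝓞 K)⁰ K)ˣ) : FractionalIdeal (𝓞 K)⁰ K) from hy)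
    exact ⟨y', rfl⟩
  · rintro ⟨y', rfl⟩
    exact ⟨(y' : K), (FractionalIdeal.mem_one_iff (S := (𝓞 K)⁰)).2 ⟨y', rfl⟩, rfl⟩

open scoped Classical in
/-- Discharge of `euclideanIdealLattice_one`. [folklore] -/
theorem euclideanIdealLattice_one_holds : euclideanIdealLattice_one K := by
  unfold euclideanIdealLattice_one euclideanIdealLattice euclidean.integerLattice
  rw [idealLattice_one]

open scoped Classical in
/-- `I` *is an ideal lattice of `K`*: the integer lattice instance `I` (dimension `I.n`, basis
matrix over `ℤ`) is, up to a linear isometry `ℝ^{I.n} ≃ₗᵢ K_ℝ` onto the Euclidean mixed space, the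
ideal lattice `σ(𝔞)` of some fractional ideal `𝔞` of `K`.  This is the promise of the worst-case
problems Ideal-SVP / Ideal-SIVP (Lyubashevsky–Peikert–Regev 2013, §2.3; Peikert 2016, §4.3.4).
Fractional and integral ideals differ by scaling by an element of `K`, which for `K`-multiples by
rationals is a homothety of `K_ℝ`; approximate SVP/SIVP are invariant under isometry and homothety, so
allowing fractional `𝔞` (Mathlib's `idealLattice` is indexed by them) is harmless.  The isometry is
into the *Euclidean* mixed space (`mixedSpace K` itself is not an inner-product space). [cite: LyubashevskyPeikertRegev2013, §2.3] -/
def IsIdealLatticeInstance (I : Literature.Algebra.EuclideanLattices.LatticeInstance) : Prop :=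
  ∃ (𝔞 : (FractionalIdeal (𝓞 K)⁰ K)ˣ) (f : EuclideanSpace ℝ (Fin I.n) ≃ₗᵢ[ℝ] euclidean.mixedSpace K),
    I.lattice.map ((f.toLinearEquiv : _ ≃ₗ[ℝ] _).restrictScalars ℤ).toLinearMap =
      euclideanIdealLattice K 𝔞

/-- An ideal-lattice instance has the dimension of the field: `I.n = [K : ℚ]` (the linear
isometry `ℝ^{I.n} ≃ K_ℝ` preserves `finrank`, and `finrank_ℝ K_ℝ = [K : ℚ]`,
Mathlib `euclidean.finrank`; proved below as `IsIdealLatticeInstance.n_eq_finrank_holds`). [folklore] -/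
def IsIdealLatticeInstance.n_eq_finrank : Prop :=
  ∀ {I : Literature.Algebra.EuclideanLattices.LatticeInstance} (h : IsIdealLatticeInstance K I),
    I.n = Module.finrank ℚ K

open scoped Classical in
/-- Discharge of `IsIdealLatticeInstance.n_eq_finrank`. [folklore] -/
theorem IsIdealLatticeInstance.n_eq_finrank_holds : IsIdealLatticeInstance.n_eq_finrank K := by
  intro I h
  obtain ⟨𝔞, f, -⟩ := h
  have h1 := f.toLinearEquiv.finrank_eq
  rw [finrank_euclideanSpace_fin, euclidean.finrank] at h1
  exact h1

/-- An ideal-lattice instance is nonsingular (its lattice is a full lattice of rank `[K : ℚ]`):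
the image `σ(𝔞)` spans `K_ℝ` over `ℝ` (`IsZLattice.span_top`), hence the `I.n` rows of the basis
matrix span `ℝ^{I.n}` and are linearly independent, i.e. `det B ≠ 0`; proved below as
`IsIdealLatticeInstance.isNonsingular_holds`. [folklore] -/
def IsIdealLatticeInstance.isNonsingular : Prop :=
  ∀ {I : Literature.Algebra.EuclideanLattices.LatticeInstance} (h : IsIdealLatticeInstance K I),
    I.IsNonsingular

open scoped Classical in
/-- The rows of an ideal-lattice instance span `ℝ^{I.n}` over `ℝ`. [folklore] -/
theorem IsIdealLatticeInstance.span_range_vec_eq_top {I : Literature.Algebra.EuclideanLattices.LatticeInstance}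
    (h : IsIdealLatticeInstance K I) :
    Submodule.span ℝ (Set.range I.vec) = ⊤ := by
  classical
  obtain ⟨𝔞, f, hf⟩ := h
  set g : EuclideanSpace ℝ (Fin I.n) ≃ₗ[ℝ] euclidean.mixedSpace K := f.toLinearEquiv
  have htop : Submodule.span ℝ ((euclideanIdealLattice K 𝔞 : Set (euclidean.mixedSpace K))) = ⊤ :=
    IsZLattice.span_top
  rw [← hf, Submodule.map_coe] at htop
  have himg : ((g.restrictScalars ℤ).toLinearMap : EuclideanSpace ℝ (Fin I.n) → euclidean.mixedSpace K) ''
      (I.lattice : Set (EuclideanSpace ℝ (Fin I.n))) = g.toLinearMap '' (I.lattice : Set _) := rfl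
  rw [himg, Submodule.span_image] at htop
  have hspan : Submodule.span ℝ (I.lattice : Set (EuclideanSpace ℝ (Fin I.n))) = ⊤ := by
    rw [eq_top_iff]
    intro x _
    have hx : g x ∈ Submodule.map g.toLinearMap (Submodule.span ℝ (I.lattice : Set _)) := by
      rw [htop]; trivial
    obtain ⟨y, hy, hyx⟩ := Submodule.mem_map.1 hx
    rwa [← g.injective hyx]
  rwa [Literature.Algebra.EuclideanLattices.LatticeInstance.lattice, Submodule.span_span_of_tower] at hspan

open scoped Classical in
/-- Discharge of `IsIdealLatticeInstance.isNonsingular`. [folklore] -/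
theorem IsIdealLatticeInstance.isNonsingular_holds : IsIdealLatticeInstance.isNonsingular K := by
  intro I h
  have hspan := IsIdealLatticeInstance.span_range_vec_eq_top K h
  have hli : LinearIndependent ℝ I.vec :=
    linearIndependent_of_top_le_span_of_card_eq_finrank hspan.ge
      (by rw [Fintype.card_fin, finrank_euclideanSpace_fin])
  have e : (fun i => I.basis.map (Int.cast : ℤ → ℝ) i) =
      (WithLp.linearEquiv 2 ℝ (Fin I.n → ℝ)) ∘ I.vec := by
    funext i; ext j; simp
  have hrows : LinearIndependent ℝ (I.basis.map (Int.cast : ℤ → ℝ)).row := by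
    change LinearIndependent ℝ (fun i => I.basis.map (Int.cast : ℤ → ℝ) i)
    rw [e]
    exact hli.map' _ (WithLp.linearEquiv 2 ℝ (Fin I.n → ℝ)).ker
  have hunit := Matrix.linearIndependent_rows_iff_isUnit.1 hrows
  rw [Matrix.isUnit_iff_isUnit_det, isUnit_iff_ne_zero, ← Int.cast_det] at hunit
  exact_mod_cast hunit

end IdealLattice

end RingLWE

end Literature.Computability.Cryptography

end
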